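import Mathlib
import HarnessLib
import Summits.ValiantsHypothesis.ValiantsHypothesis.Theorems.LacunarySymmetroidMatrixDescartesProductPlusOneMidSwitching

/-!
# ValiantsHypothesis / LacunarySymmetroid — crux `MatrixDescartes` (stmt-ValiantsHypothesis-18050, V1),
# LINE (A) «product_plus_one», floor `OneChangeFloorK3`: the ACTIVITY THRESHOLD of a riser (every support ratio)

Sequel of ✓ `…ProductPlusOneMidSwitching` (riser floor `θg/g ≥ K(ρ) + N(ρ)/|g|`, entry horizon) and ✓ `…ProductPlusOneSingleEpisode`.
Chart `g = a + b x^p + c x^q` (`p = e+1`, `q = e+k+2`), `S = p b + q c x^{q−p}`, `Ψ_j = S/g`, `Ψ_j′ = num/g²`; pull numerator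
`N = −θg`, capacity `K = θN/N`, `μ = K − p = q(q−p) c x^{q−p}/S`.  A switched incoherent row PUSHES UP at `x` iff `num(x) > 0` iff
`θg/g < μ(x)`.  Combining with the riser floor:

* ★ `activity_threshold_pos` (normalised signs `b, c < 0`): if the row vanishes at `ρ > 0`, is switched at `x` and `num(x) ≥ 0`, then
  `K(ρ) + N(ρ)/|g(x)| ≤ μ(x) = K(x) − p`, i.e. `θN(ρ)/N(ρ) + N(ρ)/(−g(x)) ≤ q(q−p)·c·x^{q−p}/S(x)`:
  a riser can push up only after its capacity has grown by MORE than `p` since birth, and only once it is OLD (`|g(x)| ≥ N(ρ)/(q−p−K(ρ))`);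
* `early_of_active` — and only if it is an EARLY riser: `q·c²·ρ^{q−p} < (q−2p)·bc` (contrapositive of ✓ `numerator_neg_of_midSwitched`);
* `capacity_lt_sub` — bookkeeping: `μ(x) < q − p` always (so the two displays force `K(ρ) < q − p − N(ρ)/|g(x)|`).

Use: with ✓ single-episode, every pushing episode `[s_j,e_j]` of an early riser starts only where `K_j ≥ K_j(ρ_j) + p + N(ρ_j)/|g_j|` — the
quantitative residue of the floor's open core («old early risers mid-wall»).
HONEST FRAMING: a row law; closes NO stub; NOT `OneChangeFloorK3` / the stubs / `MatrixDescartes`; `VP ≠ VNP` is NOT proved.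
No definitions, no named facts, no sorry; Mathlib + the lane files.

[folklore] Elementary inequalities; no citation needed.
-/

set_option linter.dupNamespace false

namespace Summit.ValiantsHypothesis.ValiantsHypothesis.Theorems.LacunarySymmetroidMatrixDescartes

namespace ProductPlusOne

/-- `μ(x) = q(q−p) c x^{q−p}/S(x) < q − p` for `b, c < 0`, `x > 0` (the capacity stays below `q`). [folklore] -/
theorem capacity_lt_sub (b c : ℝ) (e k : ℕ) (hb : b < 0) (hc : c < 0) {x : ℝ} (hx : 0 < x) :
    (e + k + 2 : ℝ) * (k + 1 : ℝ) * c * x ^ (k + 1) / ((e + 1 : ℝ) * b + (e + k + 2 : ℝ) * c * x ^ (k + 1)) < (k + 1 : ℝ) := by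
  have hxk : 0 < x ^ (k + 1) := pow_pos hx _
  have hS : (e + 1 : ℝ) * b + (e + k + 2 : ℝ) * c * x ^ (k + 1) < 0 := by
    nlinarith [mul_pos_of_neg_of_neg hc (neg_neg_of_pos hxk)]
  rw [div_lt_iff_of_neg hS]
  have : (k + 1 : ℝ) * ((e + 1 : ℝ) * b) < 0 := mul_neg_of_pos_of_neg (by positivity) (mul_neg_of_pos_of_neg (by positivity) hb)
  nlinarith

/-- **Early risers only**: a switched incoherent row (normalised `b, c < 0`, `g(x) < 0`) with `num(x) ≥ 0` was born BEFORE its entry horizon: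
`q·c²·ρ^{q−p} < (q−2p)·bc`. [this file's lemma] -/
theorem early_of_active (a b c : ℝ) (e k : ℕ) (hb : b < 0) (hc : c < 0) {ρ x : ℝ} (hρ : 0 < ρ) (hx : 0 < x)
    (hg : a + b * ρ ^ (e + 1) + c * ρ ^ (e + k + 2) = 0) (hsw : a + b * x ^ (e + 1) + c * x ^ (e + k + 2) < 0)
    (hnum : 0 ≤ ((e + k + 2 : ℝ) * c * ((k + 1 : ℝ) * x ^ k)) * (a + b * x ^ (e + 1) + c * x ^ (e + k + 2))
        - ((e + 1 : ℝ) * b + (e + k + 2 : ℝ) * c * x ^ (k + 1))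
          * (b * ((e + 1 : ℝ) * x ^ e) + c * ((e + k + 2 : ℝ) * x ^ (e + k + 1)))) :
    (e + k + 2 : ℝ) * c ^ 2 * ρ ^ (k + 1) < ((e + k + 2 : ℝ) - 2 * (e + 1 : ℝ)) * (b * c) := by
  by_contra hle
  have h := numerator_neg_of_midSwitched_pos a b c e k hb hc hρ hx hg (le_of_not_gt hle) hsw
  linarith

/-- ★ **ACTIVITY THRESHOLD** (normalised `b, c < 0`): a row vanishing at `ρ > 0`, switched at `x > 0` with `num(x) ≥ 0` satisfies
`θN(ρ)/N(ρ) + N(ρ)/(−g(x)) ≤ q(q−p)·c·x^{q−p}/S(x)` — capacity at birth plus the age term is below `μ(x) = K(x) − p`. [this file's theorem] -/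
theorem activity_threshold_pos (a b c : ℝ) (e k : ℕ) (hb : b < 0) (hc : c < 0) {ρ x : ℝ} (hρ : 0 < ρ) (hx : 0 < x)
    (hg : a + b * ρ ^ (e + 1) + c * ρ ^ (e + k + 2) = 0) (hsw : a + b * x ^ (e + 1) + c * x ^ (e + k + 2) < 0)
    (hnum : 0 ≤ ((e + k + 2 : ℝ) * c * ((k + 1 : ℝ) * x ^ k)) * (a + b * x ^ (e + 1) + c * x ^ (e + k + 2))
        - ((e + 1 : ℝ) * b + (e + k + 2 : ℝ) * c * x ^ (k + 1))
          * (b * ((e + 1 : ℝ) * x ^ e) + c * ((e + k + 2 : ℝ) * x ^ (e + k + 1)))) :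
    (-((e + 1 : ℝ) ^ 2 * b * ρ ^ (e + 1) + (e + k + 2 : ℝ) ^ 2 * c * ρ ^ (e + k + 2)))
        / (-((e + 1 : ℝ) * b * ρ ^ (e + 1) + (e + k + 2 : ℝ) * c * ρ ^ (e + k + 2)))
      + (-((e + 1 : ℝ) * b * ρ ^ (e + 1) + (e + k + 2 : ℝ) * c * ρ ^ (e + k + 2)))
        / (-(a + b * x ^ (e + 1) + c * x ^ (e + k + 2)))
      ≤ (e + k + 2 : ℝ) * (k + 1 : ℝ) * c * x ^ (k + 1) / ((e + 1 : ℝ) * b + (e + k + 2 : ℝ) * c * x ^ (k + 1)) := by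
  set g := a + b * x ^ (e + 1) + c * x ^ (e + k + 2) with hgdef
  set S := (e + 1 : ℝ) * b + (e + k + 2 : ℝ) * c * x ^ (k + 1) with hSdef
  set Nρ := -((e + 1 : ℝ) * b * ρ ^ (e + 1) + (e + k + 2 : ℝ) * c * ρ ^ (e + k + 2)) with hNρ
  set Tρ := -((e + 1 : ℝ) ^ 2 * b * ρ ^ (e + 1) + (e + k + 2 : ℝ) ^ 2 * c * ρ ^ (e + k + 2)) with hTρ
  set Nx := -((e + 1 : ℝ) * b * x ^ (e + 1) + (e + k + 2 : ℝ) * c * x ^ (e + k + 2)) with hNx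
  have hρp : 0 < ρ ^ (e + 1) := pow_pos hρ _
  have hρq : 0 < ρ ^ (e + k + 2) := pow_pos hρ _
  have hxp : 0 < x ^ (e + 1) := pow_pos hx _
  have hxk : 0 < x ^ (k + 1) := pow_pos hx _
  have hNρpos : 0 < Nρ := by
    rw [hNρ]; nlinarith [mul_pos_of_neg_of_neg hb (neg_neg_of_pos hρp), mul_pos_of_neg_of_neg hc (neg_neg_of_pos hρq)]
  have hS : S < 0 := by rw [hSdef]; nlinarith [mul_pos_of_neg_of_neg hc (neg_neg_of_pos hxk)]
  have hgneg : 0 < -g := neg_pos.2 hsw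
  -- floor: `Nρ·Nx + Tρ·g ≥ Nρ²`, i.e. `Nx/(−g) ≥ Tρ/Nρ + Nρ/(−g)`
  have hfloor : Nρ ^ 2 ≤ Nρ * Nx + Tρ * g :=
    riserFloor a b c e k (mul_pos_of_neg_of_neg hb hc).le hρ hx hg
  have hleft : Tρ / Nρ + Nρ / (-g) ≤ Nx / (-g) := by
    rw [div_add_div _ _ hNρpos.ne' hgneg.ne', div_le_div_iff₀ (mul_pos hNρpos hgneg) hgneg]
    have hsq : Nρ ^ 2 = Nρ * Nρ := sq Nρ
    have hm1 : Tρ * -g = -(Tρ * g) := mul_neg Tρ g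
    have h1 : Tρ * -g + Nρ * Nρ ≤ Nx * Nρ := by rw [hm1, ← hsq, mul_comm Nx Nρ]; linarith
    have h2 := mul_le_mul_of_nonneg_right h1 hgneg.le
    rw [mul_assoc Nx Nρ (-g)] at h2
    exact h2
  -- activity: `num ≥ 0` ⇒ `Nx/(−g) ≤ μ(x)`; `x·num = q(q−p)x^{k+1}c·g − x^{e+1}S·S`
  set Q := (e + k + 2 : ℝ) * (k + 1 : ℝ) * c * x ^ (k + 1) with hQdef
  have hNxS : Nx = -(x ^ (e + 1) * S) := by rw [hNx, hSdef]; ring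
  have hnum_x : x * (((e + k + 2 : ℝ) * c * ((k + 1 : ℝ) * x ^ k)) * g
        - S * (b * ((e + 1 : ℝ) * x ^ e) + c * ((e + k + 2 : ℝ) * x ^ (e + k + 1))))
      = Q * g - (x ^ (e + 1) * S) * S := by
    rw [hSdef, hQdef]; ring
  have hprod : 0 ≤ Q * g - (x ^ (e + 1) * S) * S := by
    rw [← hnum_x]; exact mul_nonneg hx.le hnum
  have hright : Nx / (-g) ≤ Q / S := by
    rw [← neg_div_neg_eq Q S, div_le_div_iff₀ hgneg (neg_pos.2 hS), hNxS]
    have e1 : -(x ^ (e + 1) * S) * -S = (x ^ (e + 1) * S) * S := by ring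
    have e2 : -Q * -g = Q * g := by ring
    rw [e1, e2]
    linarith
  exact hleft.trans hright

end ProductPlusOne

end Summit.ValiantsHypothesis.ValiantsHypothesis.Theorems.LacunarySymmetroidMatrixDescartes
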